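/-
Copyright: statement-level skeleton of a published paper (lit-balaban cell, Phase-2 proof seat p25, gen 22). No proof
claims beyond what the kernel checks below.
-/
import Literature.MathematicalPhysics.QuantumFieldTheory.BalabanImbrieJaffe1984to88.BIJ88WalkSplit245LettersDecay
import Literature.MathematicalPhysics.QuantumFieldTheory.BalabanImbrieJaffe1984to88.BIJ88WalkIneq312Split245
import Literature.MathematicalPhysics.QuantumFieldTheory.BalabanImbrieJaffe1984to88.BIJ88Decay241Walks

/-!
# `BalabanImbrieJaffe1984to88.BIJ88WalkIneq312Split245Decay` — T. Bałaban, J. Imbrie, A. Jaffe, *Effective action and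
cluster properties of the abelian Higgs model*, Commun. Math. Phys. **114** (1988) 257–315 [BalabanImbrieJaffe1988],
§5.14 p. 312 [PDF 56], verbatim: *"These considerations lead to the following estimate: |G_k(X)| ≤
c(F(X))(e^β(L^kε/ε₀)^{1/4−α})^{β′|X∖∪_cX_c|} × Π_{X_{σ_1} ⊂ X : dist(X_{σ_1}, Λ₁₂^{(k)c}) < r(e_k)} [c(L^kε)^{−m(c)}e^{−m′(c)}]."*,
p. 310 [PDF 54]: *"The leading terms, with only propagators C^{(k)}_{Λ₁₂^{(k)},loc}, C^{(k)}_{Λ₁₂^{(k)},loc}(u_{k+1}),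
we transform further. The others, localized in region X, have a factor of e^{−cr(e_k)|X|}."* and Sect. 2 p. 264
[PDF 8]: *"|C^{(k)}_Λ(u; x₁, x₂)| ≦ ce^{−c|x₁−x₂|}. (2.41) … The local part C^{(k)}_{Λ,loc}(u; x₁, x₂) … is bounded as in
(2.41). … |C^{(k)}_{Λ,X}(u; x₁, x₂)| ≦ e^{−cr(e_k)|X|}. (2.46)"* — **THE HEAD THEOREM OF ROW C2.Claim@312 ON PRINT'S
SPLIT WITH THE LOCAL LETTER FROM THE DECAY (2.41)** (p25 gen 22; file W6b′, a MEMBER of the row, owner r16, referee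
ref-5; companion of W6b `BIJ88WalkIneq312Split245` / W6c; the head of record and every earlier file UNCHANGED).

W6b books the local piece with `B′_loc = E_loc·D·s_c·R₁K_w` (entrywise letter × sites per cube), a letter that carries
`s_c ~ r(e_k)^d` into the head's vertex clause `hvert` — print's λ-vertices cannot pay polylogarithms of `e_k`.  Print's
*"bounded as in (2.41)"* gives more: `C_loc` DECAYS, so its column sums are `≤ K₀·C_s` with a lattice constant `C_s`
(W6a′ `BIJ88WalkSplit245LettersDecay`).  Here the head is assembled on that letter:
`ineq312_remainder_bdry_split245_of_colsum` (any column-sum letter `C_ℓ`; `B′_loc = C_ℓ·R₁K_w`) and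
`ineq312_remainder_bdry_split245_decay_walks` ([6]'s setting: (2.46) by p36's `ineq246`, the decay by p02's
`abs_cLoc_le_exp`, `C_ℓ = K₀·C_s`, `K₀ = (s₀A/(1 − D_wβ))e^{2δb₀/μ}`; the one remaining local-side letter is the
site-summability `Σ_x e^{−(δ/μ)d(x,y)} ≤ C_s`).  Conclusion and every other clause verbatim as in W6b.

statement-level skeleton of published theorems with citation tags; proofs where landed; nothing here is a claim
about the Yang–Mills mass gap

PDF held: `paper:balaban1988-cmp114-bij-abelian-higgs-effective-action` (journal page = PDF page + 256); p. 312 =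
PDF 56, p. 310 = PDF 54, p. 264 = PDF 8.

CITATION HEADER (lean-in-tree rule).  lit-balaban cell (HOME `run/shared/lean/pub/lit-balaban/`), Phase 2, seat p25
gen 22; row **C2.Claim@312** of `HOME/lit-balaban-r16/ROWS-C2-part2.md` (owner r16, referee ref-5; MEMBER); reader
edges to rows C2.Eq2.41, C2.Eq2.46 (owner r18).  USED BY NAME, nothing restated:
`BIJ88WalkProductCutoffWeighted312.ineq312_remainder_bdry_prodCutoff_of_reach` (W5), `BIJ88WalkSplitReach.{split_reach,
split_weights}` (W4c), `BIJ88WalkIneq312Split245.{split245_support_adm, split245_cube_sums}` (W6b),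
`BIJ88WalkSplit245LettersDecay.{split245_letters_of_colsum, colsum_le_of_decay}` (W6a′), `BIJ88Ineq246Walks.ineq246`
(p36), `BIJ88Decay241Walks.abs_cLoc_le_exp` (p02), the §5.13 model of record.

## What is proved (0 `sorry`, standard axioms, no new `Prop` facts; theorems only, no definitions)

* **`ineq312_remainder_bdry_split245_of_colsum`**, **`ineq312_remainder_bdry_split245_decay_walks`**.
HONEST SCOPE: as W6b/W6c; the site-summability letter `C_s` and the nonnegativity of the site distance are
hypotheses on the site metric.  NOT summit progress; NOT continuum; NOT Clay.  Imports `BIJ88WalkSplit245LettersDecay`,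
`BIJ88WalkIneq312Split245`, `BIJ88Decay241Walks`; modifies nothing.
-/

noncomputable section

namespace Literature.MathematicalPhysics.QuantumFieldTheory.BalabanImbrieJaffe1984to88.BIJ88WalkIneq312Split245Decay

open Classical MeasureTheory Matrix Finset
open scoped BigOperators ContDiff
open Literature.MathematicalPhysics.QuantumFieldTheory.Balaban1983to89
open B2Eq228Conditioning (weight source)
open BIJ88PolymerRep5134 (corner)
open BIJ88PolymerRep5134Gauss (prec src)
open BIJ88VertexIbp311 (vexp)
open BIJ88RandomWalk242
open BIJ88Ineq246Walks (ineq246)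
open BIJ88Decay241Walks (abs_cLoc_le_exp)
open BIJ88WalkSplitReach (split_reach split_weights)
open BIJ88WalkSplit245LettersDecay (split245_letters_of_colsum colsum_le_of_decay)
open BIJ88WalkIneq312Split245 (split245_support_adm split245_cube_sums)
open BIJ88WalkRun311 BIJ88WalkExpansion311 BIJ88WalkExpansionGeo311 BIJ88WalkTermCount312
  BIJ88WalkRemainderActivity312 BIJ88WalkIneq312Remainder BIJ88WalkProductCutoffWeighted312
open Literature.Probability.LatticeModels (IsRConnected)

/-! ## §1  The head on print's split, local column-sum letter as input -/

section Law

variable {ι : Type} [Fintype ι] {κ : Type} [LinearOrder κ] {β : Type} [Fintype β] [DecidableEq β]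
variable {α I : Type} [Fintype α] [DecidableEq α] [Fintype I] [DecidableEq I]
  {blk : α → I} {Δ : Matrix α α ℝ} {ℱ : α → ℝ} {W : Finset I} {J : Type} [DecidableEq J]

/-- **THE HEAD THEOREM OF ROW C2.Claim@312 ON PRINT'S SPLIT (2.45), LOCAL COLUMN-SUM LETTER AS INPUT**: W6b's
`ineq312_remainder_bdry_split245` with the local piece entering only through a bound `C_ℓ` on the column sums of
`C_loc` (`B′_loc = C_ℓ·R₁K_w`, condition `C_ℓ·R₁K_w ≤ B_ℓ`) instead of the entrywise letter `E_loc` (W6b is the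
instance `C_ℓ = E_loc·D·s_c`); the finite range of `C_loc` (`htri`, `hnear`, `near`-degree `≤ D`) still feeds the reach
data; everything else — the typed row (2.46), the per-cube animal sums, the numbers, the head's clauses and the
CONCLUSION `c_F(O) = K_V·Λ_O·(max 1 (2Φ₀(O) + L(D+1)))^{Φ₀(O)}` — verbatim as in W6b.
[cite: BalabanImbrieJaffe1988, §5.14 p.312 (estimate preceding (5.14.5)); p.310; (2.41), (2.43)-(2.46) p.264; (5.2.1)-(5.2.4) p.278] -/
theorem ineq312_remainder_bdry_split245_of_colsum (hPD : (prec blk Δ W (corner ℝ W)).PosDef)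
    (ldist : J → {x : α // blk x ∈ W} → ℝ) (ρr : ℝ) (cubeOf : J → β) (cadj : β → β → Prop)
    (Cw : Walk J → {x : α // blk x ∈ W} → {x : α // blk x ∈ W} → ℝ) (inBlock : {x : α // blk x ∈ W} → J → Prop)
    (cube : {x : α // blk x ∈ W} → β) {c rek : ℝ}
    (h246 : BIJ88Sect2Statements.Ineq246 (fun X : Finset β => X.card) (memX inBlock cubeOf cadj)
      (cX ldist ρr cubeOf cadj Cw) c rek)
    (hblk : ∀ x j, inBlock x j → cube x ∈ closure cadj {cubeOf j})
    {Cl : ℝ} (hCl0 : 0 ≤ Cl) (hCl : ∀ y', ∑ x, |cLoc ldist ρr Cw x y'| ≤ Cl)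
    (sdist : {x : α // blk x ∈ W} → {x : α // blk x ∈ W} → ℝ)
    (htri : ∀ j x₁ x₂, sdist x₁ x₂ ≤ ldist j x₁ + ldist j x₂) (near : β → β → Prop)
    (hnear : ∀ x₁ x₂, sdist x₁ x₂ ≤ 2 * ρr → near (cube x₂) (cube x₁)) {D sc : ℕ}
    (hD : ∀ k, (univ.filter fun k' => near k k').card ≤ D)
    (hsc : ∀ k, (univ.filter fun x => cube x = k).card ≤ sc)
    (Rk : β → β → Prop) (hRk : ∀ x y, Rk x y → Rk y x) {nbr : β → Finset β} {Δc : ℕ}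
    (hΔc : ∀ x, (nbr x).card ≤ Δc) (hnbr : ∀ x y, Rk x y → y ∈ nbr x)
    (hsmall : ((Δc : ℝ) + 1) ^ 2 * (Real.exp 1 * Real.exp (-(c * rek / 2))) ≤ 1 / 2)
    {Rinf R1 : ℝ} (hRinf : 0 ≤ Rinf) (hR1 : 0 ≤ R1)
    {cv : ι → ℝ} {legs : ι → List ({x : α // blk x ∈ W} → ℝ)} {obs : κ → List ({x : α // blk x ∈ W} → ℝ)} {M : ℕ}
    {oc : κ → Finset β} {vc : ι → Finset β} {cV : ι → ℝ} {Bl θ θv θw : ℝ} {legCube : ι → ℕ → β} {L : ℕ}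
    {B : Type} (Bs : Finset B) {y : B → {x : α // blk x ∈ W}} (hy : Set.InjOn y Bs)
    {g : ℝ → ℝ} (hg : ContDiff ℝ ∞ g) {cg : ℝ}
    (hgc : ∀ (n : ℕ) (x : ℝ), |iteratedDeriv n g x| ≤ cg ^ n * (n : ℝ) ^ (cg * n))
    {KV p μs vs : ℝ} (hV : ∀ φ, |vexp cv legs φ| ≤ KV) (hp1 : 1 ≤ p) (hμs : 0 ≤ μs) (hvs : 0 ≤ vs)
    (hobsm : ∀ j, ∀ w ∈ obs j, |w ⬝ᵥ ((prec blk Δ W (corner ℝ W))⁻¹ *ᵥ src blk ℱ W)| ≤ μs ∧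
      w ⬝ᵥ ((prec blk Δ W (corner ℝ W))⁻¹ *ᵥ w) ≤ vs)
    (hlegsm : ∀ m, ∀ w ∈ legs m, |w ⬝ᵥ ((prec blk Δ W (corner ℝ W))⁻¹ *ᵥ src blk ℱ W)| ≤ μs ∧
      w ⬝ᵥ ((prec blk Δ W (corner ℝ W))⁻¹ *ᵥ w) ≤ vs)
    (hθ0 : 0 < θ) (hθ1 : θ ≤ 1) (hBl : 1 ≤ Bl) (hcV0 : ∀ m, 0 ≤ cV m)
    (hθv : 0 < θv) (hθv1 : θv ≤ 1) (hθw : 0 < θw) (hθw1 : θw ≤ 1) (hcV : ∀ m, |cv m| ≤ cV m)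
    (hobs : ∀ j, ∀ w ∈ obs j, (∃ k, ∀ z, w z ≠ 0 → cube z = k) ∧ ‖w‖ ≤ Rinf ∧ ∑ x, |w x| ≤ R1)
    (hlegs : ∀ m, ∀ w ∈ legs m, (∃ k, ∀ z, w z ≠ 0 → cube z = k) ∧ ‖w‖ ≤ Rinf ∧ ∑ x, |w x| ≤ R1)
    (hvert : ∀ m, cV m * Bl ^ (legs m).length ≤ θv * θ ^ (vc m).card)
    (hleg : ∀ m j x, ((legs m).getD j 0) x ≠ 0 → cube x = legCube m j)
    (hL : ∀ k, (∑ m, ((range (legs m).length).filter fun j => legCube m j = k).card) ≤ L)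
    (h4 : 4 ≤ c * rek) (hθrek : Real.exp (-(c * rek / 4)) ≤ θ)
    (hBl' : Cl * (R1 * (Rinf + ‖src blk ℱ W‖ + 1)) ≤ Bl)
    (hθw' : Real.exp (-(c * rek / 4)) * sc * (R1 * (Rinf + ‖src blk ℱ W‖ + 1)) ≤ θw)
    (bdry : Finset κ)
    (hbeat : ∀ O : Finset κ, ∀ t ∈ expand (fun p : Option {X : Finset β // IsRConnected Rk X} =>
        (Option.elim p (cLoc ldist ρr Cw) fun r => cX ldist ρr cubeOf cadj Cw r.1 :
          Matrix {x : α // blk x ∈ W} {x : α // blk x ∈ W} ℝ)) (fun p => Option.isSome p) (src blk ℱ W) cv legs obs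
        M 0 O, t.consts = 0 → ∀ X ∈ t.groups,
      max p⁻¹ (max (θv ^ M) θw) * ∏ j ∈ X.lab.filter (fun j => j ∉ bdry), Bl ^ (obs j).length ≤ 1) :
    BIJ88Sect5StatementsPart4.Ineq312 (remSys κ β)
      (fun OX => remAt (prec blk Δ W (corner ℝ W)) (fun p : Option {X : Finset β // IsRConnected Rk X} =>
          (Option.elim p (cLoc ldist ρr Cw) fun r => cX ldist ρr cubeOf cadj Cw r.1 :
            Matrix {x : α // blk x ∈ W} {x : α // blk x ∈ W} ℝ)) (fun p => Option.isSome p) (src blk ℱ W) cv legs obs M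
        (fun ψ => ∏ b ∈ Bs, g (p⁻¹ * (ContinuousLinearMap.proj (y b) : ({x : α // blk x ∈ W} → ℝ) →L[ℝ] ℝ) ψ))
        oc vc (fun p => Option.elim p (∅ : Finset β) fun r => r.1) [] 0 OX.1 OX.2
        / ∫ φ, weight (prec blk Δ W (corner ℝ W)) φ * source (src blk ℱ W) φ)
      (fun OX => KV * ((max 1 (max 1 cg * (max 1 (phi0 legs obs M OX.1 : ℝ)) ^ cg)) ^ phi0 legs obs M OX.1
            * ∑ N ∈ range (phi0 legs obs M OX.1 + 1), 2 ^ N * (μs ^ N + (1 + vs ^ N * ((2 * N - 1).doubleFactorial : ℝ))))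
          * (max 1 (2 * (phi0 legs obs M OX.1 : ℝ) + L * ((D : ℝ) + 1))) ^ phi0 legs obs M OX.1)
      (fun OX => ∏ j ∈ OX.1.filter (fun j => j ∈ bdry), Bl ^ (obs j).length)
      (fun OX => nfreeOf oc OX.2) θ 1 := by
  -- W6a′: the seven clause inputs for the split family, local column-sum letter as input
  obtain ⟨hB0, hρ, hB, hBf, hBzN, hloc, hwalk⟩ := split245_letters_of_colsum ldist ρr cubeOf cadj Cw inBlock cube
    (IsRConnected Rk) h246 hblk hCl0 hCl hsc Bs hy (src blk ℱ W) hRinf hR1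
    (Dir := {u : {x : α // blk x ∈ W} → ℝ | (∃ k, ∀ z, u z ≠ 0 → cube z = k) ∧ ‖u‖ ≤ Rinf ∧ ∑ x, |u x| ≤ R1})
    (fun u hu => hu.2) h4 hθrek hBl' hθw'
  -- the reach data of the split (W4c) from the support inputs, and the per-cube sums (W4b on the subtype)
  obtain ⟨hnone, hsome⟩ := split245_support_adm ldist ρr cubeOf cadj Cw inBlock cube (IsRConnected Rk) h246 hblk
    sdist htri near hnear
  obtain ⟨hin, hout⟩ := split_reach (cubeOf := cube) (near := near)
    (X := fun r : {X : Finset β // IsRConnected Rk X} => r.1)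
    (Cov := fun p : Option {X : Finset β // IsRConnected Rk X} =>
      (Option.elim p (cLoc ldist ρr Cw) fun r => cX ldist ρr cubeOf cadj Cw r.1 :
        Matrix {x : α // blk x ∈ W} {x : α // blk x ∈ W} ℝ)) hnone hsome
  have hcs := split245_cube_sums Rk hRk hΔc hnbr (Real.exp_pos (-(c * rek / 2))).le hsmall
  have hw := fun k => split_weights (near := near) (X := fun r : {X : Finset β // IsRConnected Rk X} => r.1)
    (ρ := fun p : Option {X : Finset β // IsRConnected Rk X} =>
      (Option.elim p 1 fun r => Real.exp (-(c * rek / 2)) ^ r.1.card : ℝ)) hρ hD (a := 1) (b := 1)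
    (fun k => ?_) (fun k => ?_) k
  rotate_left
  · convert (hcs k).1; rfl
  · convert (hcs k).2; rfl
  -- `hL`: the head's leg-count clause carries the classical `DecidableEq` of its abstract cube type (`convert`)
  refine ineq312_remainder_bdry_prodCutoff_of_reach
    (Cov := fun p : Option {X : Finset β // IsRConnected Rk X} =>
      (Option.elim p (cLoc ldist ρr Cw) fun r => cX ldist ρr cubeOf cadj Cw r.1 :
        Matrix {x : α // blk x ∈ W} {x : α // blk x ∈ W} ℝ))
    (trig := fun p => Option.isSome p) (reg := fun p => Option.elim p (∅ : Finset β) fun r => r.1)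
    (Dir := {u : {x : α // blk x ∈ W} → ℝ | (∃ k, ∀ z, u z ≠ 0 → cube z = k) ∧ ‖u‖ ≤ Rinf ∧ ∑ x, |u x| ≤ R1})
    (ρ₀ := 2) (ρ₁ := (D : ℝ) + 1) (cubeOf := cube) (legCube := legCube) (L := L)
    hPD Bs (fun b => ContinuousLinearMap.proj (y b)) hg hgc hV hp1 hμs hvs hobsm hlegsm hθ0 hθ1 hBl hB0 hρ hcV0
    hθv hθv1 hθw hθw1 hB hBf hBzN hcV (fun j w hw => hobs j w hw) (fun m w hw => hlegs m w hw) hloc hwalk hvert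
    zero_le_two hin hout (fun u hu => hu.1) hleg (fun k => ?_)
    (fun k => (hw k).1.trans (by norm_num)) (fun k => (hw k).2.trans (le_of_eq (by simp only [Option.elim, one_mul])))
    bdry hbeat
  convert hL k


end Law

/-! ## §2  In the setting of [6]: (2.46) and the decay (2.41) by name -/

section Walks

variable {ι : Type} [Fintype ι] {κ : Type} [LinearOrder κ] {β : Type} [Fintype β] [DecidableEq β]
variable {α I : Type} [Fintype α] [DecidableEq α] [Fintype I] [DecidableEq I]
  {blk : α → I} {Δ : Matrix α α ℝ} {ℱ : α → ℝ} {W : Finset I} {J : Type} [Fintype J] [DecidableEq J]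

/-- **THE HEAD THEOREM OF ROW C2.Claim@312 ON PRINT'S SPLIT (2.45), IN THE SETTING OF [6], DECAY LETTER**:
`ineq312_remainder_bdry_split245_of_colsum` with the typed row (2.46) DISCHARGED by p36's `BIJ88Ineq246Walks.ineq246`
(`c := δ/(32K²M_w)`) and the local column-sum letter DISCHARGED from p02's two-constant decay
`BIJ88Decay241Walks.abs_cLoc_le_exp` (`|C_loc(x₁,x₂)| ≤ K₀e^{−(δ/μ)d(x₁,x₂)}`, `K₀ := (s₀A/(1 − D_wβ))e^{2δb₀/μ}`) and a
site-summability letter `Σ_x e^{−(δ/μ)d(x,y)} ≤ C_s` (`C_ℓ = K₀·C_s`; B_ℓ condition `K₀·C_s·R₁K_w ≤ B_ℓ`, free of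
`r(e_k)`), i.e. under [6]'s hypotheses: walk kernels `|C_ω(x₁,x₂)| ≤ A·β^{|ω|}`
vanishing unless `ω` is a nearest-neighbour walk from a block of `x₁` to a block of `x₂`, out-degree `≤ D_w`,
`D_wβ ≤ e^{−δ}`, `≤ s₀` blocks per site (walks written `γ` here: `ω` is notation in the `ContDiff` scope), label distance `d` (`≤ 1` across adjacent labels), touching cubes (degree
`≤ K`, non-touching cubes `≥ s` apart), `ldist` `μ`-Lipschitz with blocks of radius `b₀`, `s/8 ≤ (ρ − b₀)/μ`,
`r(e_k) ≤ M_w·s`, `s₀A/(1 − D_wβ) ≤ e^{δs/(32K²)}`, the site-summability letter `C_s ≥ 0`; all other clauses as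
in W6b. [cite: BalabanImbrieJaffe1988, §5.14 p.312 (estimate preceding (5.14.5)); p.310; (2.41), (2.43)-(2.46) p.264; (5.2.1)-(5.2.4) p.278] -/
theorem ineq312_remainder_bdry_split245_decay_walks (hPD : (prec blk Δ W (corner ℝ W)).PosDef)
    (adj : J → J → Prop) [DecidableRel adj] (ldist : J → {x : α // blk x ∈ W} → ℝ) (ρr : ℝ) (cubeOf : J → β)
    (cadj : β → β → Prop) [DecidableRel cadj] (Cw : Walk J → {x : α // blk x ∈ W} → {x : α // blk x ∈ W} → ℝ)
    (inBlock : {x : α // blk x ∈ W} → J → Prop) (cube : {x : α // blk x ∈ W} → β)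
    -- [6]'s setting (p36/p02's typing)
    (d : J → J → ℝ) (hd0 : ∀ i, d i i = 0) (hdsymm : ∀ i l, d i l = d l i)
    (htrid : ∀ i j l, d i l ≤ d i j + d j l) (hadj : ∀ i l, adj i l → d i l ≤ 1)
    (touch : β → β → Prop) [DecidableRel touch] (hrefl : ∀ c, touch c c)
    (htsymm : ∀ c c', touch c c' → touch c' c) {K : ℕ}
    (hK : ∀ (c : β) (Y : Finset β), (Y.filter fun c' => touch c c').card ≤ K)
    (hKc : ∀ c : β, (Finset.univ.filter fun c' => c = c' ∨ cadj c c').card ≤ K)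
    {s : ℕ} (hfar : ∀ i l, ¬ touch (cubeOf i) (cubeOf l) → (s : ℝ) ≤ d i l)
    {μ b₀ : ℝ} (hμ : 0 < μ) (hld : ∀ (i l : J) (x : {x : α // blk x ∈ W}), ldist l x ≤ ldist i x + μ * d i l)
    (hb : ∀ (x : {x : α // blk x ∈ W}) (i : J), inBlock x i → ldist i x ≤ b₀) (hρ8 : (s : ℝ) / 8 ≤ (ρr - b₀) / μ)
    {A βw δ : ℝ} {Dw s₀ : ℕ} (hA : 0 ≤ A) (hβ0 : 0 ≤ βw)
    (hDw : ∀ j, (Finset.univ.filter fun i => adj j i).card ≤ Dw) (hδ : 0 < δ)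
    (hDβ : (Dw : ℝ) * βw ≤ Real.exp (-δ))
    (hmaj : ∀ γ x₁ x₂, |Cw γ x₁ x₂| ≤ A * βw ^ γ.len)
    (hnz : ∀ γ x₁ x₂, Cw γ x₁ x₂ ≠ 0 → γ.IsNN adj ∧ inBlock x₁ γ.start ∧ inBlock x₂ γ.last)
    (hS₀ : ∀ x, ∃ S₀ : Finset J, S₀.card ≤ s₀ ∧ ∀ i, inBlock x i → i ∈ S₀)
    {Mw rek : ℝ} (hMw : 0 < Mw) (hs : rek ≤ Mw * s)
    (hlarge : s₀ * A / (1 - Dw * βw) ≤ Real.exp (δ * s / (32 * K * K)))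
    {c : ℝ} (hc : c = δ / (32 * K * K * Mw))
    {K₀ : ℝ} (hK₀ : K₀ = s₀ * A / (1 - Dw * βw) * Real.exp (2 * δ * b₀ / μ))
    -- the remaining geometry, as in W6b, plus the site-summability letter
    (hblk : ∀ x j, inBlock x j → cube x ∈ closure cadj {cubeOf j})
    (sdist : {x : α // blk x ∈ W} → {x : α // blk x ∈ W} → ℝ) {Cs : ℝ} (hCs0 : 0 ≤ Cs)
    (hsum : ∀ y', ∑ x, Real.exp (-(δ / μ * sdist x y')) ≤ Cs)
    (htri : ∀ j x₁ x₂, sdist x₁ x₂ ≤ ldist j x₁ + ldist j x₂) (near : β → β → Prop)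
    (hnear : ∀ x₁ x₂, sdist x₁ x₂ ≤ 2 * ρr → near (cube x₂) (cube x₁)) {D sc : ℕ}
    (hD : ∀ k, (univ.filter fun k' => near k k').card ≤ D)
    (hsc : ∀ k, (univ.filter fun x => cube x = k).card ≤ sc)
    (Rk : β → β → Prop) (hRk : ∀ x y, Rk x y → Rk y x) {nbr : β → Finset β} {Δc : ℕ}
    (hΔc : ∀ x, (nbr x).card ≤ Δc) (hnbr : ∀ x y, Rk x y → y ∈ nbr x)
    (hsmall : ((Δc : ℝ) + 1) ^ 2 * (Real.exp 1 * Real.exp (-(c * rek / 2))) ≤ 1 / 2)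
    {Rinf R1 : ℝ} (hRinf : 0 ≤ Rinf) (hR1 : 0 ≤ R1)
    {cv : ι → ℝ} {legs : ι → List ({x : α // blk x ∈ W} → ℝ)} {obs : κ → List ({x : α // blk x ∈ W} → ℝ)} {M : ℕ}
    {oc : κ → Finset β} {vc : ι → Finset β} {cV : ι → ℝ} {Bl θ θv θw : ℝ} {legCube : ι → ℕ → β} {L : ℕ}
    {B : Type} (Bs : Finset B) {y : B → {x : α // blk x ∈ W}} (hy : Set.InjOn y Bs)
    {g : ℝ → ℝ} (hg : ContDiff ℝ ∞ g) {cg : ℝ}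
    (hgc : ∀ (n : ℕ) (x : ℝ), |iteratedDeriv n g x| ≤ cg ^ n * (n : ℝ) ^ (cg * n))
    {KV p μs vs : ℝ} (hV : ∀ φ, |vexp cv legs φ| ≤ KV) (hp1 : 1 ≤ p) (hμs : 0 ≤ μs) (hvs : 0 ≤ vs)
    (hobsm : ∀ j, ∀ w ∈ obs j, |w ⬝ᵥ ((prec blk Δ W (corner ℝ W))⁻¹ *ᵥ src blk ℱ W)| ≤ μs ∧
      w ⬝ᵥ ((prec blk Δ W (corner ℝ W))⁻¹ *ᵥ w) ≤ vs)
    (hlegsm : ∀ m, ∀ w ∈ legs m, |w ⬝ᵥ ((prec blk Δ W (corner ℝ W))⁻¹ *ᵥ src blk ℱ W)| ≤ μs ∧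
      w ⬝ᵥ ((prec blk Δ W (corner ℝ W))⁻¹ *ᵥ w) ≤ vs)
    (hθ0 : 0 < θ) (hθ1 : θ ≤ 1) (hBl : 1 ≤ Bl) (hcV0 : ∀ m, 0 ≤ cV m)
    (hθv : 0 < θv) (hθv1 : θv ≤ 1) (hθw : 0 < θw) (hθw1 : θw ≤ 1) (hcV : ∀ m, |cv m| ≤ cV m)
    (hobs : ∀ j, ∀ w ∈ obs j, (∃ k, ∀ z, w z ≠ 0 → cube z = k) ∧ ‖w‖ ≤ Rinf ∧ ∑ x, |w x| ≤ R1)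
    (hlegs : ∀ m, ∀ w ∈ legs m, (∃ k, ∀ z, w z ≠ 0 → cube z = k) ∧ ‖w‖ ≤ Rinf ∧ ∑ x, |w x| ≤ R1)
    (hvert : ∀ m, cV m * Bl ^ (legs m).length ≤ θv * θ ^ (vc m).card)
    (hleg : ∀ m j x, ((legs m).getD j 0) x ≠ 0 → cube x = legCube m j)
    (hL : ∀ k, (∑ m, ((range (legs m).length).filter fun j => legCube m j = k).card) ≤ L)
    (h4 : 4 ≤ c * rek) (hθrek : Real.exp (-(c * rek / 4)) ≤ θ)
    (hBl' : K₀ * Cs * (R1 * (Rinf + ‖src blk ℱ W‖ + 1)) ≤ Bl)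
    (hθw' : Real.exp (-(c * rek / 4)) * sc * (R1 * (Rinf + ‖src blk ℱ W‖ + 1)) ≤ θw)
    (bdry : Finset κ)
    (hbeat : ∀ O : Finset κ, ∀ t ∈ expand (fun p : Option {X : Finset β // IsRConnected Rk X} =>
        (Option.elim p (cLoc ldist ρr Cw) fun r => cX ldist ρr cubeOf cadj Cw r.1 :
          Matrix {x : α // blk x ∈ W} {x : α // blk x ∈ W} ℝ)) (fun p => Option.isSome p) (src blk ℱ W) cv legs obs
        M 0 O, t.consts = 0 → ∀ X ∈ t.groups,
      max p⁻¹ (max (θv ^ M) θw) * ∏ j ∈ X.lab.filter (fun j => j ∉ bdry), Bl ^ (obs j).length ≤ 1) :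
    BIJ88Sect5StatementsPart4.Ineq312 (remSys κ β)
      (fun OX => remAt (prec blk Δ W (corner ℝ W)) (fun p : Option {X : Finset β // IsRConnected Rk X} =>
          (Option.elim p (cLoc ldist ρr Cw) fun r => cX ldist ρr cubeOf cadj Cw r.1 :
            Matrix {x : α // blk x ∈ W} {x : α // blk x ∈ W} ℝ)) (fun p => Option.isSome p) (src blk ℱ W) cv legs obs M
        (fun ψ => ∏ b ∈ Bs, g (p⁻¹ * (ContinuousLinearMap.proj (y b) : ({x : α // blk x ∈ W} → ℝ) →L[ℝ] ℝ) ψ))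
        oc vc (fun p => Option.elim p (∅ : Finset β) fun r => r.1) [] 0 OX.1 OX.2
        / ∫ φ, weight (prec blk Δ W (corner ℝ W)) φ * source (src blk ℱ W) φ)
      (fun OX => KV * ((max 1 (max 1 cg * (max 1 (phi0 legs obs M OX.1 : ℝ)) ^ cg)) ^ phi0 legs obs M OX.1
            * ∑ N ∈ range (phi0 legs obs M OX.1 + 1), 2 ^ N * (μs ^ N + (1 + vs ^ N * ((2 * N - 1).doubleFactorial : ℝ))))
          * (max 1 (2 * (phi0 legs obs M OX.1 : ℝ) + L * ((D : ℝ) + 1))) ^ phi0 legs obs M OX.1)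
      (fun OX => ∏ j ∈ OX.1.filter (fun j => j ∈ bdry), Bl ^ (obs j).length)
      (fun OX => nfreeOf oc OX.2) θ 1 := by
  -- (2.46) PROVED in [6]'s setting (p36), with the rate `c = δ/(32K²M_w)`
  have h246 : BIJ88Sect2Statements.Ineq246 (fun X : Finset β => X.card) (memX inBlock cubeOf cadj)
      (cX ldist ρr cubeOf cadj Cw) c rek := by
    rw [hc]
    exact ineq246 adj ldist ρr cubeOf cadj Cw inBlock d hd0 hdsymm htrid hadj touch hrefl htsymm hK hKc hfar hμ hld hb
      hρ8 hA hβ0 hDw hδ hDβ hmaj hnz hS₀ hMw hs hlarge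
  -- the `C_loc` column-sum letter from p02's two-constant decay and the site-summability letter
  have hθlt : (Dw : ℝ) * βw < 1 := hDβ.trans_lt (Real.exp_lt_one_iff.mpr (neg_lt_zero.mpr hδ))
  have hK0 : 0 ≤ K₀ := by
    rw [hK₀]
    exact mul_nonneg (div_nonneg (mul_nonneg (Nat.cast_nonneg _) hA) (by linarith)) (Real.exp_pos _).le
  have hdec : ∀ x₁ x₂, |cLoc ldist ρr Cw x₁ x₂| ≤ K₀ * Real.exp (-(δ / μ * sdist x₁ x₂)) := fun x₁ x₂ => by
    rw [hK₀, ← neg_mul]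
    exact abs_cLoc_le_exp adj ldist ρr Cw inBlock d hd0 hdsymm htrid hadj hμ hld hb sdist htri hA hβ0 hDw hδ hDβ hmaj
      hnz hS₀ x₁ x₂
  exact ineq312_remainder_bdry_split245_of_colsum hPD ldist ρr cubeOf cadj Cw inBlock cube h246 hblk (mul_nonneg hK0 hCs0)
    (fun y' => colsum_le_of_decay _ sdist hK0 hdec hsum y') sdist htri near hnear hD hsc Rk hRk hΔc hnbr hsmall hRinf
    hR1 Bs hy hg hgc hV hp1 hμs hvs hobsm hlegsm hθ0 hθ1 hBl hcV0 hθv hθv1 hθw hθw1 hcV hobs hlegs hvert hleg hL h4 hθrek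
    hBl' hθw' bdry hbeat

end Walks

end Literature.MathematicalPhysics.QuantumFieldTheory.BalabanImbrieJaffe1984to88.BIJ88WalkIneq312Split245Decay

end
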